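import Summits.NavierStokesRegularity.NavierStokesRegularity.Theses.AxisymmetricExtremality
import Summits.NavierStokesRegularity.NavierStokesRegularity.Theorems.AxisymmetricExtremalityAxisymmetricKatoGlobalStubKatoAxisymSingularPoint
import Summits.NavierStokesRegularity.NavierStokesRegularity.Theorems.AxisymmetricLiouvilleBoundedSwirl
import Literature.Analysis.FluidPDE.RusinSverakSingularPoint
import Literature.Analysis.FluidPDE.AxisymmetricTypeIBounded
import HarnessLib.Audit

/-!
# Strategist s18 (independent census, family `s`) — typed signatures of the attempts

Crux `AxisymmetricExtremality.AxisymmetricKatoGlobal` (item `stmt-NavierStokesRegularity-15453`).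
This file only TYPES the statements discussed in `STRATEGY-CENSUS-s18.md` and kernel-checks the
pure-logic seams (no `sorry`):

* §W  the weakest intermediate the route's `closes` actually consumes (`NoAxisymMinimalDatum`):
      `closes_of_noAxisymMinimalDatum` (it replaces the crux in `closes` verbatim) and
      `noAxisymMinimalDatum_of_crux` (the crux implies it);
* §Z  the sharpest typed decomposition found (Q. S. Zhang, arXiv:2604.07785 Thm 1.1, "partial
      Type I"): `RadialInflowPartialTypeI` (OPEN, a priori) + `ZhangPartialTypeICriterionKato`
      (print + Kato-class transfer) + the LANDED stub 1 ⇒ crux, composition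
      `AxisymmetricKatoGlobal_of_partialTypeI` (sorry-free, hypotheses by name);
* §L  the Liouville split: `NonconstantAncientLimit` (OPEN for Type II) + the conjecture leaf
      `AxisymmetricLiouvilleBoundedSwirl` (OPEN) — seam `AxisymmetricKatoGlobal_of_liouvilleSplit`;
* §Q  the quantitative strengthening `AxisymmetricKatoGlobalQuant` (⇒ crux, `crux_of_quant`).
-/

noncomputable section

open Set MeasureTheory Filter Topology Function Metric
open scoped ENNReal NNReal
open Literature.Analysis.FluidPDE Literature.Analysis.FunctionSpaces

namespace Summit.NavierStokesRegularity.NavierStokesRegularity.Cruxes.AxisymmetricKatoGlobal.StrategistS18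

set_option linter.unusedVariables false
set_option linter.dupNamespace false

local notation "ℝ³" => EuclideanSpace ℝ (Fin 3)

open Theses.AxisymmetricExtremality

/-! ## §W — weakest intermediate consumed by `closes` -/

/-- (W) No axisymmetric datum lies in Rusin–Šverák's minimal blow-up set `M(ν)`: the exact
instance of the crux that the route's deciding theorem uses. -/
def NoAxisymMinimalDatum : Prop :=
  ∀ ν : ℝ, 0 < ν → ¬ ∃ (u₀ : ℝ³ → ℝ³) (g : HomSobolev ℝ³ (EuclideanSpace ℂ (Fin 3)) (1 / 2 : ℝ)),
    IsMinimalBlowupDatum ν u₀ g ∧ IsAxisymmetric u₀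

/-- `closes` with the crux replaced by (W): same two other cruxes, same conclusion, pure logic. -/
theorem closes_of_noAxisymMinimalDatum (h₂ : MinimalDatumPFold) (h₄ : PFoldToAxisymmetric)
    (hW : NoAxisymMinimalDatum) : NavierStokesRegularity := by
  show Literature.NS.NavierStokesExistenceSmoothR3
  intro ν hν u₀ hsm hdiv hdec
  by_contra hno
  obtain ⟨u₁, g, hmin, hax⟩ := h₄ ν hν (h₂ ν hν ⟨u₀, hsm, hdiv, hdec, hno⟩)
  exact hW ν hν ⟨u₁, g, hmin, fun θ x => hax θ x⟩

/-- The crux implies (W) (so (W) is formally weaker; strictly, unless every axisymmetric blow-up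
datum could be pushed down to the threshold `ρ_max`). -/
theorem noAxisymMinimalDatum_of_crux (h₃ : AxisymmetricKatoGlobal) : NoAxisymMinimalDatum := by
  rintro ν hν ⟨u₁, g, ⟨hL3, hrep, hdiv₁, -, hnot⟩, hax⟩
  exact hnot (h₃ ν hν u₁ g hL3 hrep hdiv₁ (fun θ x => hax θ x))

/-! ## §Z — the partial-Type-I decomposition (Zhang 2026) -/

/-- Radial (cylindrical, about the `x₂`-axis) component `v_r = (x₀v₀ + x₁v₁)/r` of a field at `x`
(junk value `0` on the axis, where `cylRadius x = 0`). -/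
def radialComponent (v : ℝ³ → ℝ³) (x : ℝ³) : ℝ := (x 0 * v x 0 + x 1 * v x 1) / cylRadius x

/-- (Z1, OPEN — a priori) One-sided Type I control of the radial INFLOW up to the final time: for
an axisymmetric Kato solution on `[0,T)`, smooth on `(0,T) × ℝ³`, and every `0 < t₀ < T`, there is
`c` with `v_r(t,x) ≥ -c/√(T-t)` on `[t₀,T) × ℝ³`.  Trivial for `T < T_max`; the content is
`T = T_max`.  Implied by the crux (bounded solutions); with (Z2) it implies the crux. -/
def RadialInflowPartialTypeI : Prop :=
  ∀ ν : ℝ, 0 < ν → ∀ T : ℝ, 0 < T → ∀ (u₀ : ℝ³ → ℝ³) (u : ℝ → ℝ³ → ℝ³),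
    IsKatoSolutionOn T ν u₀ u → ContDiffOn ℝ (⊤ : ℕ∞) (uncurry u) (Ioo 0 T ×ˢ univ) →
    (∀ t ∈ Ioo 0 T, IsAxisymmetric (u t)) →
    ∀ t₀ ∈ Ioo 0 T, ∃ c : ℝ, ∀ t ∈ Ico t₀ T, ∀ x : ℝ³,
      -c / Real.sqrt (T - t) ≤ radialComponent (u t) x

/-- (Z2, PRINT + TRANSFER) Zhang's criterion (arXiv:2604.07785, Thm 1.1: Leray–Hopf, data in
`L² ∩ L^∞ ∩ C³` with `r v_θ(·,0) ∈ L^∞`, `v_r ≥ -c/√(T-t)` on `ℝ³ × [0,T)` ⇒ bounded and smooth on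
`[0,T]`), transported to axisymmetric Kato solutions below a final time (Calderón splitting, far-field
bound of Kato solutions, local maximum principle for `Γ` — the same transfer the registered line's
stubs K/2b'/2c' performed for Seregin's criterion): partial Type I on `[t₀,T)` ⇒ bounded near
`(T, x_*)` for every `x_*`. -/
def ZhangPartialTypeICriterionKato : Prop :=
  ∀ ν : ℝ, 0 < ν → ∀ T : ℝ, 0 < T → ∀ (u₀ : ℝ³ → ℝ³) (u : ℝ → ℝ³ → ℝ³),
    IsKatoSolutionOn T ν u₀ u → ContDiffOn ℝ (⊤ : ℕ∞) (uncurry u) (Ioo 0 T ×ˢ univ) →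
    (∀ t ∈ Ioo 0 T, IsAxisymmetric (u t)) →
    (∃ t₀ ∈ Ioo 0 T, ∃ c : ℝ, ∀ t ∈ Ico t₀ T, ∀ x : ℝ³,
      -c / Real.sqrt (T - t) ≤ radialComponent (u t) x) →
    ∀ xs : ℝ³, ∃ r : ℝ, 0 < r ∧ ∃ K : ℝ, ∀ t ∈ Ioo (T - r ^ 2) T, ∀ x ∈ ball xs r, ‖u t x‖ ≤ K

/-- A pointwise bound on the backward cylinder makes the `L^∞` norm on `parabolicCylinder` finite
(support lemma, same as the registered skeleton's). -/
theorem eLpNorm_parabolicCylinder_lt_top_of_bound {u : ℝ → ℝ³ → ℝ³} {T r K : ℝ} {xs : ℝ³}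
    (h : ∀ t ∈ Ioo (T - r ^ 2) T, ∀ x ∈ ball xs r, ‖u t x‖ ≤ K) :
    eLpNorm (uncurry u) ∞ (volume.restrict (parabolicCylinder r (T, xs))) < ∞ := by
  have hmeas : MeasurableSet (parabolicCylinder r ((T, xs) : ℝ × ℝ³)) := by
    unfold parabolicCylinder
    exact measurableSet_Ioo.prod measurableSet_ball
  have hbound : ∀ᵐ z ∂(volume.restrict (parabolicCylinder r ((T, xs) : ℝ × ℝ³))),
      ‖uncurry u z‖ ≤ K := by
    filter_upwards [ae_restrict_mem hmeas] with z hz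
    obtain ⟨ht, hx⟩ := mem_prod.1 hz
    exact h z.1 ht z.2 hx
  rw [eLpNorm_exponent_top]
  exact (eLpNormEssSup_le_of_ae_bound hbound).trans_lt ENNReal.ofReal_lt_top

/-- **Composition of the split (kernel-checked seam).** (Z1) + (Z2) + the LANDED stub 1
(`Theorems.AxisymmetricKatoGlobal.Registered.stub_katoAxisymSingularPoint`, p149337) ⇒ the crux BY
NAME.  By contradiction: singular point `(T, x_*)`; (Z1) on `[T/2, T)`; (Z2) bounds `u` near
`(T, x_*)`; finiteness of the `L^∞` norm contradicts the singularity. -/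
theorem AxisymmetricKatoGlobal_of_partialTypeI (hZ1 : RadialInflowPartialTypeI)
    (hZ2 : ZhangPartialTypeICriterionKato) : AxisymmetricKatoGlobal := by
  have h1 := Theorems.AxisymmetricKatoGlobal.Registered.stub_katoAxisymSingularPoint
  intro ν hν u₀ g hL3 hrep hdiv hax
  have hax' : IsAxisymmetric u₀ := fun θ x => hax θ x
  by_contra hng
  obtain ⟨T, hT, xs, u, hK, hsm, haxi, hsing⟩ := h1 ν hν u₀ hL3 hdiv hax' hng
  have ht₀ : T / 2 ∈ Ioo 0 T := ⟨by linarith, by linarith⟩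
  obtain ⟨c, hc⟩ := hZ1 ν hν T hT u₀ u hK hsm haxi (T / 2) ht₀
  obtain ⟨r, hr, K, hbd⟩ := hZ2 ν hν T hT u₀ u hK hsm haxi ⟨T / 2, ht₀, c, hc⟩ xs
  exact absurd (hsing r hr) (eLpNorm_parabolicCylinder_lt_top_of_bound hbd).ne

/-! ## §L — the Liouville split -/

/-- (L1, OPEN for Type II) Blow-up of an axisymmetric Kato solution produces a NON-CONSTANT bounded
ancient mild solution (`ν = 1` after rescaling), axisymmetric with bounded swirl.  Known only under a
Type I rate (KNSS 2009 §6 / Seregin–Šverák 2009), where the sup-normalised rescalings cannot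
flatten; for Type II the limit may be constant. -/
def NonconstantAncientLimit : Prop :=
  ∀ ν : ℝ, 0 < ν → ∀ (u₀ : ℝ³ → ℝ³), MemLp u₀ 3 volume → IsWeaklyDivFree u₀ → IsAxisymmetric u₀ →
    ¬ HasGlobalKatoSolution ν u₀ →
    ∃ U : ℝ → ℝ³ → ℝ³, IsBoundedAncientMildSolution 1 U ∧
      (∀ t < 0, AEStronglyMeasurable (U t) volume) ∧ (∀ t < 0, IsAxisymmetric (U t)) ∧
      (∃ C : ℝ, ∀ t < 0, ∀ x, |swirl (U t) x| ≤ C) ∧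
      ¬ ∀ t < 0, ∃ b : ℝ³, U t =ᵐ[volume] fun _ => b

/-- Seam of the Liouville split: (L1) + the conjecture leaf (AX-L)
`Summit.NavierStokesRegularity.NavierStokesRegularity.AxisymmetricLiouvilleBoundedSwirl` ⇒ crux. -/
theorem AxisymmetricKatoGlobal_of_liouvilleSplit (hL1 : NonconstantAncientLimit)
    (hL2 : Summit.NavierStokesRegularity.NavierStokesRegularity.AxisymmetricLiouvilleBoundedSwirl) :
    AxisymmetricKatoGlobal := by
  intro ν hν u₀ g hL3 hrep hdiv hax
  have hax' : IsAxisymmetric u₀ := fun θ x => hax θ x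
  by_contra hng
  obtain ⟨U, hU, hmeas, haxU, hsw, hnc⟩ := hL1 ν hν u₀ hL3 hdiv hax' hng
  exact hnc (hL2 U hU hmeas haxU hsw)

/-! ## §Q — quantitative strengthening -/

/-- (Q) Quantitative axisymmetric regularity in the critical class: a global Kato solution with the
`L³` norm bounded for all time by a function of `‖u₀‖_{L³}` alone.  Implies the crux trivially;
the converse ("qualitative ⇒ quantitative") is the usual compactness/persistence argument and is
NOT proved here. -/
def AxisymmetricKatoGlobalQuant : Prop :=
  ∀ ν : ℝ, 0 < ν → ∃ F : ℝ≥0∞ → ℝ≥0∞, (∀ a, a < ∞ → F a < ∞) ∧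
    ∀ (u₀ : ℝ³ → ℝ³) (g : HomSobolev ℝ³ (EuclideanSpace ℂ (Fin 3)) (1 / 2 : ℝ)),
      MemLp u₀ 3 volume → g.Represents (Literature.Analysis.FunctionSpaces.EuclideanSpace.complexify ∘ u₀) →
      IsWeaklyDivFree u₀ → IsAxisymmetric u₀ →
      HasGlobalKatoSolution ν u₀ ∧
        ∃ u : ℝ → ℝ³ → ℝ³, (∀ T, 0 < T → IsKatoSolutionOn T ν u₀ u) ∧
          ∀ t, 0 ≤ t → eLpNorm (u t) 3 volume ≤ F (eLpNorm u₀ 3 volume)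

theorem crux_of_quant (hQ : AxisymmetricKatoGlobalQuant) : AxisymmetricKatoGlobal := by
  intro ν hν u₀ g hL3 hrep hdiv hax
  obtain ⟨F, -, hF⟩ := hQ ν hν
  exact (hF u₀ g hL3 hrep hdiv (fun θ x => hax θ x)).1

end Summit.NavierStokesRegularity.NavierStokesRegularity.Cruxes.AxisymmetricKatoGlobal.StrategistS18
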